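import Mathlib.LinearAlgebra.Matrix.Permanent
import Mathlib.Data.Complex.Basic
import Mathlib.Data.Fin.Tuple.Sort
import Mathlib.Algebra.BigOperators.Fin
import Mathlib.Data.Fintype.BigOperators
import Literature.LinearAlgebra.Matrix.PermanentSubperm
import Summits.ValiantsHypothesis.ValiantsHypothesis.Theorems.SymPencilPerFourSingularLocusSupportMonomials
import Summits.ValiantsHypothesis.ValiantsHypothesis.Theorems.SymPencilPerFourSingularLocusSupportCover

/-!
# The support theorem for `Sing(per₄)`
# (helper for crux `CoverDecancellation`, `--supports` stmt-ValiantsHypothesis-17819; RULING g12-R132 (a))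

**Theorem** (`support_of_subperm_vanish`).  Let `R` be a commutative domain with `(12 : R) ≠ 0` and
`M : Matrix (Fin 4) (Fin 4) R` a matrix all of whose sixteen `3 × 3` sub-permanents vanish — over `ℂ`,
a point of `Sing(per₄) = V(∂ per₄)`.  Then

* `M` has a zero ROW, or a zero COLUMN, or
* an ANTI-BLOCK zero pattern: `M i j = 0` whenever `[i ∈ I] = [j ∈ J]`, for 2-sets `I, J ⊆ [4]`, or
* CROSS support: `M i j = 0` off `row i₀ ∪ column j₀`.

All four occur on `Sing(per₄)` (two zero lines; one zero row `[u;v;w;0]` with `det B(u,v) = 0`,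
`w ∈ ker B(u,v)`, `B(u,v)ᵢⱼ = uᵢvⱼ + uⱼvᵢ` — an 8-dimensional family whose general member has exactly four
zeros; anti-block with `per A = per B = 0`; the 7-dimensional linear space of cross matrices), so the
list is sharp as a list of zero patterns; `12 ≠ 0` is needed (in characteristic 3 every rank-one
matrix is singular on `per₄ = 0`).

Proof.  By `SymPencilPerFourSingularLocusSupportCover.checkSorted_eq` (kernel) every zero pattern
with sorted row and column zero-counts contains a terminal pattern (done) or misses one of the 720
images of the supports `U₁`, `U₂`, `U₂ᵀ` of the monomials of
`SymPencilPerFourSingularLocusSupportMonomials`; in the latter case the reindexed (transposed) matrix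
has all entries of `U₁`/`U₂` non-zero, contradicting `12 · monomial = 0` in a domain.  A general `M`
is first brought to sorted form by a row and a column permutation (`Tuple.sort` on the zero counts),
which preserves the hypothesis, and the conclusion is transported back.

Use.  Closes `stub_noZeroLine_zeros` of `Cruxes/CoverDecancellation/Lines/sing_height_cascade.lean`
(val-idea-18) by name, and is PART A of the kernel proof of `codim Sing(per₄) ≥ 7`
(`Lines/sing_per4_height.lean`, val-idea-10), the input `h7` of the rung `StrengthTwoPerFourGeFour`
(«str₂(per₄) ≥ 4», `PolyaContinuedLaplaceRigidity.Strength.strengthTwoPerFourGeFour_of_seven_le_height`).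
No summit-level statement is touched.  val-idea-10 g2, 2026-08-28.  No `sorry`, no new definitions.
-/

set_option linter.dupNamespace false

namespace Summit.ValiantsHypothesis.ValiantsHypothesis.Theorems.SymPencilPerFourSingularLocusSupportPatterns

open Matrix
open Summit.ValiantsHypothesis.ValiantsHypothesis.Theorems.SymPencilPerFourSingularLocusSupportCover
open Summit.ValiantsHypothesis.ValiantsHypothesis.Theorems.SymPencilPerFourSingularLocusSupportMonomials

variable {R : Type*} [CommRing R]

/-! ## §1 The hypothesis is stable under reindexing and transposition -/

/-- The minors `M.submatrix r.succAbove c.succAbove` as sub-permanents. -/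
theorem permanent_minor_eq_subperm (N : Matrix (Fin 4) (Fin 4) R) (r c : Fin 4) :
    (N.submatrix r.succAbove c.succAbove).permanent = N.subperm (· ≠ c) (· ≠ r) := by
  rw [N.subperm_eq_permanent_of_equiv (finSuccAboveEquiv c) (finSuccAboveEquiv r)]
  rfl

/-- Row and column permutations preserve «all `3 × 3` sub-permanents vanish». -/
theorem subpermVanish_reindex {M : Matrix (Fin 4) (Fin 4) R}
    (h : ∀ r c : Fin 4, (M.submatrix r.succAbove c.succAbove).permanent = 0)
    (σ τ : Equiv.Perm (Fin 4)) (r c : Fin 4) :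
    ((M.submatrix σ τ).submatrix r.succAbove c.succAbove).permanent = 0 := by
  have key : ((M.submatrix σ τ).submatrix r.succAbove c.succAbove).permanent =
      M.subperm (· ≠ τ c) (· ≠ σ r) := by
    rw [M.subperm_eq_permanent_of_equiv
      ((finSuccAboveEquiv c).trans (τ.subtypeEquiv fun a => by simp [τ.injective.ne_iff]))
      ((finSuccAboveEquiv r).trans (σ.subtypeEquiv fun a => by simp [σ.injective.ne_iff]))]
    rfl
  rw [key, ← permanent_minor_eq_subperm]
  exact h (σ r) (τ c)

/-- Transposition preserves «all `3 × 3` sub-permanents vanish». -/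
theorem subpermVanish_transpose {M : Matrix (Fin 4) (Fin 4) R}
    (h : ∀ r c : Fin 4, (M.submatrix r.succAbove c.succAbove).permanent = 0) (r c : Fin 4) :
    (Mᵀ.submatrix r.succAbove c.succAbove).permanent = 0 := by
  rw [← transpose_submatrix, permanent_transpose]
  exact h c r

/-! ## §2 The zero pattern as a mask, and its row / column counts -/

/-- The zero pattern of `M` is a 16-bit mask. -/
theorem exists_zmask (M : Matrix (Fin 4) (Fin 4) R) :
    ∃ z : ℕ, z < 65536 ∧ ∀ c : Fin 4 × Fin 4, z.testBit (bitIdx c) = true ↔ M c.1 c.2 = 0 := by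
  classical
  refine ⟨maskOf (allCells.filter fun c => decide (M c.1 c.2 = 0)), ?_, fun c => ?_⟩
  · have : maskOf (allCells.filter fun c => decide (M c.1 c.2 = 0)) < 2 ^ 16 := by
      refine Nat.lt_pow_two_of_testBit _ fun i hi => ?_
      cases h : (maskOf (allCells.filter fun c => decide (M c.1 c.2 = 0))).testBit i with
      | false => rfl
      | true =>
          exfalso
          obtain ⟨c, -, hc⟩ := (testBit_maskOf _ _).1 h
          have := bitIdx_lt c
          omega
    simpa using this
  · rw [testBit_maskOf]
    constructor
    · rintro ⟨c', hc', he⟩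
      obtain rfl := bitIdx_injective he
      simpa [List.mem_filter, mem_allCells] using hc'
    · intro h0
      exact ⟨c, by simpa [List.mem_filter, mem_allCells] using h0, rfl⟩

/-- One bit as an indicator. -/
theorem toNat_testBit_eq {M : Matrix (Fin 4) (Fin 4) R} {z : ℕ} [DecidableEq R]
    (hz : ∀ c : Fin 4 × Fin 4, z.testBit (bitIdx c) = true ↔ M c.1 c.2 = 0) (i j : Fin 4) :
    (z.testBit (bitIdx (i, j))).toNat = if M i j = 0 then 1 else 0 := by
  by_cases h : M i j = 0
  · rw [(hz (i, j)).2 h]; simp [h]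
  · have : z.testBit (bitIdx (i, j)) = false := by
      cases hb : z.testBit (bitIdx (i, j)) with
      | false => rfl
      | true => exact absurd ((hz (i, j)).1 hb) h
    rw [this]; simp [h]

/-- Row zero-counts of the mask are row zero-counts of the matrix. -/
theorem rcnt_eq_card {M : Matrix (Fin 4) (Fin 4) R} {z : ℕ} [DecidableEq R]
    (hz : ∀ c : Fin 4 × Fin 4, z.testBit (bitIdx c) = true ↔ M c.1 c.2 = 0) (i : Fin 4) :
    rcnt z i = (Finset.univ.filter fun j : Fin 4 => M i j = 0).card := by
  rw [Finset.card_filter, Fin.sum_univ_four, ← toNat_testBit_eq hz, ← toNat_testBit_eq hz,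
    ← toNat_testBit_eq hz, ← toNat_testBit_eq hz]
  simp only [rcnt, bitIdx]
  fin_cases i <;> rfl

/-- Column zero-counts of the mask are column zero-counts of the matrix. -/
theorem ccnt_eq_card {M : Matrix (Fin 4) (Fin 4) R} {z : ℕ} [DecidableEq R]
    (hz : ∀ c : Fin 4 × Fin 4, z.testBit (bitIdx c) = true ↔ M c.1 c.2 = 0) (j : Fin 4) :
    ccnt z j = (Finset.univ.filter fun i : Fin 4 => M i j = 0).card := by
  rw [Finset.card_filter, Fin.sum_univ_four, ← toNat_testBit_eq hz, ← toNat_testBit_eq hz,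
    ← toNat_testBit_eq hz, ← toNat_testBit_eq hz]
  simp only [ccnt, bitIdx]
  fin_cases j <;> rfl

/-! ## §3 Sorting rows and columns by their zero counts -/

/-- Some row permutation and some column permutation make both zero-count sequences monotone. -/
theorem exists_sorted [DecidableEq R] (M : Matrix (Fin 4) (Fin 4) R) :
    ∃ σ τ : Equiv.Perm (Fin 4),
      Monotone (fun i => (Finset.univ.filter fun j : Fin 4 => M.submatrix σ τ i j = 0).card) ∧
      Monotone (fun j => (Finset.univ.filter fun i : Fin 4 => M.submatrix σ τ i j = 0).card) := by
  set f : Fin 4 → ℕ := fun i => (Finset.univ.filter fun j : Fin 4 => M i j = 0).card with hf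
  set g : Fin 4 → ℕ := fun j => (Finset.univ.filter fun i : Fin 4 => M i j = 0).card with hg
  refine ⟨Tuple.sort f, Tuple.sort g, ?_, ?_⟩
  · have hrow : ∀ (σ τ : Equiv.Perm (Fin 4)) (i : Fin 4),
        (Finset.univ.filter fun j : Fin 4 => M.submatrix σ τ i j = 0).card = f (σ i) := by
      intro σ τ i
      simp only [hf, submatrix_apply]
      exact Finset.card_bij (fun j _ => τ j) (fun j hj => by simpa using hj)
        (fun a _ b _ h => τ.injective h)
        (fun b hb => ⟨τ.symm b, by simpa using hb, by simp⟩)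
    simp only [hrow]
    exact Tuple.monotone_sort f
  · have hcol : ∀ (σ τ : Equiv.Perm (Fin 4)) (j : Fin 4),
        (Finset.univ.filter fun i : Fin 4 => M.submatrix σ τ i j = 0).card = g (τ j) := by
      intro σ τ j
      simp only [hg, submatrix_apply]
      exact Finset.card_bij (fun i _ => σ i) (fun i hi => by simpa using hi)
        (fun a _ b _ h => σ.injective h)
        (fun b hb => ⟨σ.symm b, by simpa using hb, by simp⟩)
    simp only [hcol]
    exact Tuple.monotone_sort g

/-- Transport of the four-way conclusion along a reindexing. -/
theorem concl_of_submatrix (M : Matrix (Fin 4) (Fin 4) R) (σ τ : Equiv.Perm (Fin 4))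
    (h : (∃ i : Fin 4, ∀ j : Fin 4, M.submatrix σ τ i j = 0) ∨
      (∃ j : Fin 4, ∀ i : Fin 4, M.submatrix σ τ i j = 0) ∨
      (∃ i₁ i₂ j₁ j₂ : Fin 4, i₁ ≠ i₂ ∧ j₁ ≠ j₂ ∧
        ∀ i j : Fin 4, ((i = i₁ ∨ i = i₂) ↔ (j = j₁ ∨ j = j₂)) → M.submatrix σ τ i j = 0) ∨
      (∃ i₀ j₀ : Fin 4, ∀ i j : Fin 4, i ≠ i₀ → j ≠ j₀ → M.submatrix σ τ i j = 0)) :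
    (∃ i : Fin 4, ∀ j : Fin 4, M i j = 0) ∨ (∃ j : Fin 4, ∀ i : Fin 4, M i j = 0) ∨
    (∃ i₁ i₂ j₁ j₂ : Fin 4, i₁ ≠ i₂ ∧ j₁ ≠ j₂ ∧
        ∀ i j : Fin 4, ((i = i₁ ∨ i = i₂) ↔ (j = j₁ ∨ j = j₂)) → M i j = 0) ∨
    (∃ i₀ j₀ : Fin 4, ∀ i j : Fin 4, i ≠ i₀ → j ≠ j₀ → M i j = 0) := by
  simp only [submatrix_apply] at h
  rcases h with ⟨i, hi⟩ | ⟨j, hj⟩ | ⟨i₁, i₂, j₁, j₂, hne, hne', hH⟩ | ⟨i₀, j₀, hX⟩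
  · exact Or.inl ⟨σ i, fun j => by simpa using hi (τ.symm j)⟩
  · exact Or.inr (Or.inl ⟨τ j, fun i => by simpa using hj (σ.symm i)⟩)
  · refine Or.inr (Or.inr (Or.inl ⟨σ i₁, σ i₂, τ j₁, τ j₂, σ.injective.ne hne, τ.injective.ne hne',
      fun i j hij => ?_⟩))
    have := hH (σ.symm i) (τ.symm j) (by
      simpa only [Equiv.symm_apply_eq, eq_comm (a := i), eq_comm (a := j)] using hij)
    simpa using this
  · refine Or.inr (Or.inr (Or.inr ⟨σ i₀, τ j₀, fun i j hi hj => ?_⟩))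
    have := hX (σ.symm i) (τ.symm j) (by simpa [Equiv.symm_apply_eq] using hi)
      (by simpa [Equiv.symm_apply_eq] using hj)
    simpa using this

/-! ## §4 The support theorem -/

/-- The sorted case: read the kernel cover fact. -/
theorem support_of_sorted [IsDomain R] [DecidableEq R] (h12 : (12 : R) ≠ 0)
    (N : Matrix (Fin 4) (Fin 4) R)
    (hN : ∀ r c : Fin 4, (N.submatrix r.succAbove c.succAbove).permanent = 0)
    (hrow : Monotone (fun i => (Finset.univ.filter fun j : Fin 4 => N i j = 0).card))
    (hcol : Monotone (fun j => (Finset.univ.filter fun i : Fin 4 => N i j = 0).card)) :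
    (∃ i : Fin 4, ∀ j : Fin 4, N i j = 0) ∨ (∃ j : Fin 4, ∀ i : Fin 4, N i j = 0) ∨
    (∃ i₁ i₂ j₁ j₂ : Fin 4, i₁ ≠ i₂ ∧ j₁ ≠ j₂ ∧
        ∀ i j : Fin 4, ((i = i₁ ∨ i = i₂) ↔ (j = j₁ ∨ j = j₂)) → N i j = 0) ∨
    (∃ i₀ j₀ : Fin 4, ∀ i j : Fin 4, i ≠ i₀ → j ≠ j₀ → N i j = 0) := by
  classical
  obtain ⟨z, hz, hzb⟩ := exists_zmask N
  -- the mask is count-sorted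
  have hs : sortedB z = true := by
    have r := rcnt_eq_card hzb
    have c := ccnt_eq_card hzb
    have m01 := hrow (show (0 : Fin 4) ≤ 1 by decide)
    have m12 := hrow (show (1 : Fin 4) ≤ 2 by decide)
    have m23 := hrow (show (2 : Fin 4) ≤ 3 by decide)
    have n01 := hcol (show (0 : Fin 4) ≤ 1 by decide)
    have n12 := hcol (show (1 : Fin 4) ≤ 2 by decide)
    have n23 := hcol (show (2 : Fin 4) ≤ 3 by decide)
    simp only at m01 m12 m23 n01 n12 n23
    rw [← r, ← r] at m01 m12 m23
    rw [← c, ← c] at n01 n12 n23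
    simp only [sortedB, Bool.and_eq_true, decide_eq_true_eq]
    exact ⟨⟨⟨m01, m12⟩, m23⟩, ⟨n01, n12⟩, n23⟩
  have hok := ok_of_sorted z hz hs
  unfold ok at hok
  rw [Bool.or_eq_true, List.any_eq_true, List.any_eq_true] at hok
  have rd : ∀ c : Fin 4 × Fin 4, z.testBit (bitIdx c) = true → N c.1 c.2 = 0 :=
    fun c hc => (hzb c).1 hc
  rcases hok with ⟨m, hm, hzm⟩ | ⟨u, hu, hzu⟩
  · -- a terminal pattern inside the zero pattern
    have hzm' : z &&& m = m := by simpa using hzm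
    have up : ∀ c : Fin 4 × Fin 4, m.testBit (bitIdx c) = true → N c.1 c.2 = 0 :=
      fun c hc => rd c (testBit_of_and_eq_self hzm' _ hc)
    rcases termSem_of_mem_termGen hm with ⟨i, hi⟩ | ⟨j, hj⟩ | ⟨i₁, i₂, j₁, j₂, hne, hne', hH⟩ |
      ⟨i₀, j₀, hX⟩
    · exact Or.inl ⟨i, fun j => up (i, j) (hi j)⟩
    · exact Or.inr (Or.inl ⟨j, fun i => up (i, j) (hj i)⟩)
    · exact Or.inr (Or.inr (Or.inl ⟨i₁, i₂, j₁, j₂, hne, hne', fun i j hij => up (i, j) (hH i j hij)⟩))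
    · exact Or.inr (Or.inr (Or.inr ⟨i₀, j₀, fun i j hi hj => up (i, j) (hX i j hi hj)⟩))
  · -- an image of `U₁ / U₂ / U₂ᵀ` avoids the zero pattern: contradiction in a domain
    exfalso
    have hzu' : z &&& u = 0 := by simpa using hzu
    have nz : ∀ c : Fin 4 × Fin 4, u.testBit (bitIdx c) = true → N c.1 c.2 ≠ 0 := by
      intro c hc h0
      have := testBit_of_and_eq_zero hzu' _ hc
      rw [(hzb c).2 h0] at this
      exact Bool.noConfusion this
    obtain ⟨σ, τ, k, hσ, hτ, rfl⟩ := exists_wit_of_mem_imageMasks hu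
    set σe := Equiv.ofBijective σ hσ
    set τe := Equiv.ofBijective τ hτ
    have hcell : ∀ c ∈ baseCells k, N (σ c.1) (τ c.2) ≠ 0 := by
      intro c hc
      apply nz (imgCell σ τ c)
      rw [testBit_maskOf]
      exact ⟨imgCell σ τ c, List.mem_map.2 ⟨c, hc, rfl⟩, rfl⟩
    have hN' := subpermVanish_reindex hN σe τe
    have e : ∀ i j, N.submatrix σe τe i j = N (σ i) (τ j) := fun i j => rfl
    rcases k with _ | _ | k
    · -- `U₁`
      have h := twelve_mul_monomial₁_eq_zero (N.submatrix σe τe) hN'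
      simp only [e] at h
      refine (mul_ne_zero h12 ?_) h
      have a := hcell (0,2) (by decide); have b := hcell (0,3) (by decide)
      have c := hcell (1,1) (by decide); have d := hcell (2,0) (by decide)
      have f := hcell (3,0) (by decide)
      exact mul_ne_zero (mul_ne_zero (mul_ne_zero (mul_ne_zero a b) (pow_ne_zero 3 c)) d)
        (pow_ne_zero 3 f)
    · -- `U₂`
      have h := twelve_mul_monomial₂_eq_zero (N.submatrix σe τe) hN'
      simp only [e] at h
      refine (mul_ne_zero h12 ?_) h
      have a := hcell (0,0) (by decide); have b := hcell (0,1) (by decide)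
      have c := hcell (0,3) (by decide); have d := hcell (1,2) (by decide)
      have f := hcell (2,1) (by decide); have g := hcell (3,0) (by decide)
      exact mul_ne_zero (mul_ne_zero (mul_ne_zero (mul_ne_zero (mul_ne_zero a b) c)
        (pow_ne_zero 2 d)) (pow_ne_zero 2 f)) (pow_ne_zero 2 g)
    · -- `U₂ᵀ`: apply the second monomial to the transpose
      have h := twelve_mul_monomial₂_eq_zero (N.submatrix σe τe)ᵀ (subpermVanish_transpose hN')
      simp only [transpose_apply, e] at h
      refine (mul_ne_zero h12 ?_) h
      have a := hcell (0,0) (by simp [baseCells]); have b := hcell (1,0) (by simp [baseCells])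
      have c := hcell (3,0) (by simp [baseCells]); have d := hcell (2,1) (by simp [baseCells])
      have f := hcell (1,2) (by simp [baseCells]); have g := hcell (0,3) (by simp [baseCells])
      exact mul_ne_zero (mul_ne_zero (mul_ne_zero (mul_ne_zero (mul_ne_zero a b) c)
        (pow_ne_zero 2 d)) (pow_ne_zero 2 f)) (pow_ne_zero 2 g)

/-- **Support theorem for `Sing(per₄)`.**  In a domain with `12 ≠ 0`, a `4 × 4` matrix all of whose
`3 × 3` sub-permanents vanish has a zero row, a zero column, an anti-block zero pattern, or is
supported on a cross `row i₀ ∪ column j₀`. -/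
theorem support_of_subperm_vanish [IsDomain R] (h12 : (12 : R) ≠ 0)
    (M : Matrix (Fin 4) (Fin 4) R)
    (h : ∀ r c : Fin 4, (M.submatrix r.succAbove c.succAbove).permanent = 0) :
    (∃ i : Fin 4, ∀ j : Fin 4, M i j = 0) ∨ (∃ j : Fin 4, ∀ i : Fin 4, M i j = 0) ∨
    (∃ i₁ i₂ j₁ j₂ : Fin 4, i₁ ≠ i₂ ∧ j₁ ≠ j₂ ∧
        ∀ i j : Fin 4, ((i = i₁ ∨ i = i₂) ↔ (j = j₁ ∨ j = j₂)) → M i j = 0) ∨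
    (∃ i₀ j₀ : Fin 4, ∀ i j : Fin 4, i ≠ i₀ → j ≠ j₀ → M i j = 0) := by
  classical
  obtain ⟨σ, τ, hrow, hcol⟩ := exists_sorted M
  exact concl_of_submatrix M σ τ
    (support_of_sorted h12 (M.submatrix σ τ) (subpermVanish_reindex h σ τ) hrow hcol)

/-- The same over `ℂ` (the case used for `Sing(per₄)`), hypothesis-free. -/
theorem support_of_subperm_vanish_complex (M : Matrix (Fin 4) (Fin 4) ℂ)
    (h : ∀ r c : Fin 4, (M.submatrix r.succAbove c.succAbove).permanent = 0) :
    (∃ i : Fin 4, ∀ j : Fin 4, M i j = 0) ∨ (∃ j : Fin 4, ∀ i : Fin 4, M i j = 0) ∨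
    (∃ i₁ i₂ j₁ j₂ : Fin 4, i₁ ≠ i₂ ∧ j₁ ≠ j₂ ∧
        ∀ i j : Fin 4, ((i = i₁ ∨ i = i₂) ↔ (j = j₁ ∨ j = j₂)) → M i j = 0) ∨
    (∃ i₀ j₀ : Fin 4, ∀ i j : Fin 4, i ≠ i₀ → j ≠ j₀ → M i j = 0) :=
  support_of_subperm_vanish (by norm_num) M h

end Summit.ValiantsHypothesis.ValiantsHypothesis.Theorems.SymPencilPerFourSingularLocusSupportPatterns
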